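import Literature.NumberTheory.LFunctions.EquivalentsKeiperLiProofs
import Literature.NumberTheory.LFunctions.ZetaArgVariation
import Literature.NumberTheory.LFunctions.LogZetaClassicalRegion
import Literature.Analysis.SpecialFunctions.PolygammaSeries
import HarnessLib

/-!
# Taylor coefficients of `log ξ(s)` at `s = 1` and Li's coefficients

Xiao, *Recurrence relations of Li coefficients* (arXiv:2006.13103, 2020) studies the Li
coefficients `λ_n = Σ_ρ [1 − (1 − 1/ρ)ⁿ]` (Li 1997), i.e.
`λ_n = (1/(n−1)!) dⁿ/dsⁿ [s^{n−1} log ξ(s)]_{s=1}` — the tree's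
`Literature.NumberTheory.LFunctions.keiperLiCoeff` — and poses (Conj. 3.4) the convexity
inequality `λ_n > 2λ_{n−1} − λ_{n−2}` for all `n ≥ 3`. This file supplies the exact identities
through which the `λ_n` are computed from elementary constants in
`Xiao2020/Certificate.lean` (where Conj. 3.4 is refuted at `n = 119`):

* `keiperLiCoeff_eq_sum_logXiTaylorCoeff` : `λ_n = Σ_{j<n} C(n,j+1)(j+1)·Re a_{j+1}` with
  `a_k = (log ξ)^{(k)}(1)/k!` (Leibniz, from `iteratedDeriv_pow_mul_one_eq_sum`);
* `logXiTaylorCoeff_succ` : for `k ≥ 1`,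
  `(k+1)·a_{k+1} = q_k + (−1)^k (1 − (1 − 2^{−(k+1)}) ζ(k+1))`, where
  `q_k = (ζ₁'/ζ₁)^{(k)}(1)/k!`, `ζ₁(s) = (s−1)ζ(s)`; this is `ξ'/ξ = 1/s + Γℝ'/Γℝ + ζ₁'/ζ₁`
  (`logDeriv_riemannXi_eq`), `Γℝ'/Γℝ(s) = −½ log π + ½ψ(s/2)` (`logDeriv_Gammaℝ`), the polygamma
  series at `s = 1` (`hasSum_iteratedDeriv_digamma_half`) and `Σ_j (2j+1)^{−k} = (1−2^{−k})ζ(k)`;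
* `sum_zetaOneTaylorCoeff_mul` : the convolution `Σ_{i≤m} u_i q_{m−i} = (m+1) u_{m+1}`,
  `u_i = ζ₁^{(i)}(1)/i!` (Leibniz on `ζ₁ · (ζ₁'/ζ₁) = ζ₁'` near `1`), which determines the `q_m`
  from the `u_i` (`u_0 = 1`);
* `zetaOneTaylorCoeff_im` : the `u_i` are real (Schwarz reflection).

[cite: Xiao2020, §1 and Conj. 3.4] [cite: Li1997, (1.3)–(1.4)] [cite: Keiper1992, §2]
-/

open Complex Finset Filter Topology
open scoped Nat
open Literature.NumberTheory.LFunctions Literature.Analysis.SpecialFunctions.Complex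

namespace Literature.NumberTheory.LFunctions.Xiao2020

/-- `u_i = ζ₁^{(i)}(1)/i!`, the Taylor coefficients at `s = 1` of the entire function
`ζ₁(s) = (s−1)ζ(s)` (`u_0 = 1`, `u_1 = γ`). [cite: Keiper1992, §2] -/
noncomputable def zetaOneTaylorCoeff (i : ℕ) : ℂ := iteratedDeriv i riemannZeta₁ 1 / (i ! : ℂ)

/-- `q_m = (ζ₁'/ζ₁)^{(m)}(1)/m!`, the Taylor coefficients at `s = 1` of the logarithmic
derivative of `ζ₁(s) = (s−1)ζ(s)`. [cite: Keiper1992, §2] -/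
noncomputable def zetaOneLogDerivCoeff (m : ℕ) : ℂ :=
  iteratedDeriv m (logDeriv riemannZeta₁) 1 / (m ! : ℂ)

/-- `a_k = (log ξ)^{(k)}(1)/k!`, the Taylor coefficients at `s = 1` of the principal logarithm of
Riemann's `ξ`. [cite: Li1997, (1.4)] -/
noncomputable def logXiTaylorCoeff (k : ℕ) : ℂ :=
  iteratedDeriv k (fun s ↦ Complex.log (riemannXi s)) 1 / (k ! : ℂ)

/-! ## `λ_n` from the Taylor coefficients of `log ξ` -/

/-- **Li's coefficients from the Taylor coefficients of `log ξ` at `1`**: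
`λ_n = Σ_{j<n} C(n,j+1)·(j+1)·Re a_{j+1}` for `n ≥ 1`. [cite: Li1997, (1.3)–(1.4)] -/
theorem keiperLiCoeff_eq_sum_logXiTaylorCoeff {n : ℕ} (hn : 1 ≤ n) :
    keiperLiCoeff n =
      ∑ j ∈ range n, ((n.choose (j + 1) * (j + 1) : ℕ) : ℝ) * (logXiTaylorCoeff (j + 1)).re := by
  unfold keiperLiCoeff
  rw [iteratedDeriv_pow_mul_one_eq_sum hn (analyticAt_log_riemannXi_one.contDiffAt),
    sum_div, Complex.re_sum]
  refine sum_congr rfl fun j _ ↦ ?_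
  have hf : ((n - 1)! : ℂ) ≠ 0 := by exact_mod_cast Nat.factorial_ne_zero _
  have hj : (j ! : ℂ) ≠ 0 := by exact_mod_cast Nat.factorial_ne_zero _
  have hj1 : ((j + 1)! : ℂ) ≠ 0 := by exact_mod_cast Nat.factorial_ne_zero _
  have hD : iteratedDeriv (j + 1) (fun s ↦ Complex.log (riemannXi s)) 1 =
      ((j + 1)! : ℂ) * logXiTaylorCoeff (j + 1) := by
    unfold logXiTaylorCoeff
    field_simp
  rw [hD]
  have : (n.choose (j + 1) : ℂ) * (((n - 1)! : ℂ) / (j ! : ℂ)) *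
        (((j + 1)! : ℂ) * logXiTaylorCoeff (j + 1)) / ((n - 1)! : ℂ) =
      (((n.choose (j + 1) * (j + 1) : ℕ) : ℝ) : ℂ) * logXiTaylorCoeff (j + 1) := by
    rw [Nat.factorial_succ]
    push_cast
    field_simp
  rw [this, Complex.re_ofReal_mul]

/-! ## The logarithmic derivative near `s = 1` -/

/-- `ξ'/ξ = 1/s + Γℝ'/Γℝ + ζ₁'/ζ₁` in a neighbourhood of `s = 1`. [folklore] -/
theorem logDeriv_riemannXi_eventuallyEq_one :
    logDeriv riemannXi =ᶠ[𝓝 (1 : ℂ)]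
      fun s ↦ s⁻¹ + (logDeriv Gammaℝ s + logDeriv riemannZeta₁ s) := by
  filter_upwards [riemannZeta₁_ne_zero_of_near_one,
    (isOpen_lt continuous_const Complex.continuous_re).mem_nhds
      (show (0 : ℝ) < (1 : ℂ).re by simp)] with s hζ hs
  rw [logDeriv_riemannXi_eq hs hζ, one_div, add_assoc]

/-- `dᵏ/dsᵏ (1/s) |_{s=1} = (−1)^k k!`. [folklore] -/
theorem iteratedDeriv_inv_one (k : ℕ) :
    iteratedDeriv k (fun s : ℂ ↦ s⁻¹) 1 = (-1) ^ k * (k ! : ℂ) := by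
  have := Literature.Analysis.Complex.iteratedDeriv_inv_add_const 0 k 1
  simp only [add_zero, one_pow, inv_one, mul_one] at this
  exact this

/-- `ζ₁'/ζ₁` is analytic at `s = 1` (`ζ₁(1) = 1`). [folklore] -/
theorem analyticAt_logDeriv_riemannZeta₁_one : AnalyticAt ℂ (logDeriv riemannZeta₁) 1 := by
  have ha : AnalyticAt ℂ riemannZeta₁ 1 := differentiable_riemannZeta₁.analyticAt 1
  show AnalyticAt ℂ (fun z ↦ deriv riemannZeta₁ z / riemannZeta₁ z) 1
  exact ha.deriv.div ha (by rw [riemannZeta₁_one]; exact one_ne_zero)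

/-- `dᵏ/dsᵏ (Γℝ'/Γℝ)(1) = (−1)^{k+1} k! Σ_j (2j+1)^{−(k+1)}` for `k ≥ 1`. [folklore] -/
theorem hasSum_iteratedDeriv_logDeriv_Gammaℝ_one {k : ℕ} (hk : 1 ≤ k) :
    HasSum (fun j : ℕ ↦ (-1) ^ (k + 1) * (k ! : ℂ) * (((1 : ℂ) + 2 * (j : ℂ)) ^ (k + 1))⁻¹)
      (iteratedDeriv k (logDeriv Gammaℝ) 1) := by
  have hev : logDeriv Gammaℝ =ᶠ[𝓝 (1 : ℂ)]
      fun s ↦ -(Complex.log Real.pi) / 2 + Complex.digamma (s / 2) / 2 := by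
    filter_upwards [(isOpen_lt continuous_const Complex.continuous_re).mem_nhds
      (show (0 : ℝ) < (1 : ℂ).re by simp)] with s hs
    exact logDeriv_Gammaℝ (half_ne_neg_nat_of_re_pos' hs)
  have h2 : iteratedDeriv k (fun s ↦ -(Complex.log Real.pi) / 2 + Complex.digamma (s / 2) / 2) 1 =
      iteratedDeriv k (fun s ↦ Complex.digamma (s / 2) / 2) 1 := iteratedDeriv_const_add hk _
  rw [hev.iteratedDeriv_eq k, h2]
  exact hasSum_iteratedDeriv_digamma_half (s := 1) (by simp) hk

/-- `Σ_{j≥0} (2j+1)^{−k} = (1 − 2^{−k}) ζ(k)` for `k ≥ 2`. [folklore] -/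
theorem hasSum_inv_odd_pow {k : ℕ} (hk : 2 ≤ k) :
    HasSum (fun j : ℕ ↦ (((1 : ℂ) + 2 * (j : ℂ)) ^ k)⁻¹) ((1 - 1 / 2 ^ k) * riemannZeta k) := by
  have hk1 : 1 < k := hk
  set f : ℕ → ℂ := fun n ↦ 1 / (n : ℂ) ^ k with hf
  have hsumR : Summable (fun n : ℕ ↦ 1 / (n : ℝ) ^ k) := Real.summable_one_div_nat_pow.2 hk1
  have hsum : Summable f := by
    have := (Complex.ofRealCLM.summable hsumR)
    refine this.congr fun n ↦ ?_
    simp [f]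
  have hζ : HasSum f (riemannZeta k) := by
    rw [zeta_nat_eq_tsum_of_gt_one hk1]
    exact hsum.hasSum
  have heven : HasSum (fun m : ℕ ↦ f (2 * m)) (1 / 2 ^ k * riemannZeta k) := by
    refine (hζ.mul_left (1 / 2 ^ k)).congr_fun fun m ↦ ?_
    simp only [f]
    push_cast
    rw [mul_pow]
    ring
  have hinj : Function.Injective fun m : ℕ ↦ 2 * m + 1 := fun a b h ↦ by simpa using h
  have hodd : HasSum (fun m : ℕ ↦ f (2 * m + 1)) (∑' m : ℕ, f (2 * m + 1)) :=
    (hsum.comp_injective hinj).hasSum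
  have htot := heven.even_add_odd hodd
  have huniq := hζ.unique htot
  have hval : ∑' m : ℕ, f (2 * m + 1) = (1 - 1 / 2 ^ k) * riemannZeta k := by
    linear_combination -huniq
  rw [← hval]
  refine hodd.congr_fun fun m ↦ ?_
  simp only [f]
  push_cast
  rw [one_div]
  ring

/-- **Taylor coefficients of `log ξ` at `1` from those of `ζ₁'/ζ₁`**: for `k ≥ 1`,
`(k+1)·a_{k+1} = q_k + (−1)^k (1 − (1 − 2^{−(k+1)}) ζ(k+1))`. [cite: Keiper1992, §2] -/
theorem logXiTaylorCoeff_succ {k : ℕ} (hk : 1 ≤ k) :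
    ((k : ℂ) + 1) * logXiTaylorCoeff (k + 1) =
      zetaOneLogDerivCoeff k +
        (-1) ^ k * (1 - (1 - 1 / 2 ^ (k + 1)) * riemannZeta ((k + 1 : ℕ) : ℂ)) := by
  have h1 := iteratedDeriv_succ_log_riemannXi_one k
  have h2 : iteratedDeriv k (logDeriv riemannXi) 1 =
      iteratedDeriv k (fun s ↦ s⁻¹ + (logDeriv Gammaℝ s + logDeriv riemannZeta₁ s)) 1 :=
    logDeriv_riemannXi_eventuallyEq_one.iteratedDeriv_eq k
  have hinv : ContDiffAt ℂ k (fun s : ℂ ↦ s⁻¹) 1 := contDiffAt_inv ℂ one_ne_zero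
  have hΓ : ContDiffAt ℂ k (logDeriv Gammaℝ) 1 :=
    (analyticAt_logDeriv_Gammaℝ (by simp)).contDiffAt
  have hζ : ContDiffAt ℂ k (logDeriv riemannZeta₁) 1 :=
    analyticAt_logDeriv_riemannZeta₁_one.contDiffAt
  have h3 : iteratedDeriv k (fun s ↦ s⁻¹ + (logDeriv Gammaℝ s + logDeriv riemannZeta₁ s)) 1 =
      iteratedDeriv k (fun s : ℂ ↦ s⁻¹) 1 +
        (iteratedDeriv k (logDeriv Gammaℝ) 1 + iteratedDeriv k (logDeriv riemannZeta₁) 1) := by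
    rw [iteratedDeriv_fun_add hinv (hΓ.add hζ), iteratedDeriv_fun_add hΓ hζ]
  have hG := (hasSum_iteratedDeriv_logDeriv_Gammaℝ_one hk).tsum_eq
  have hO := (hasSum_inv_odd_pow (k := k + 1) (by omega)).tsum_eq
  have hG' : iteratedDeriv k (logDeriv Gammaℝ) 1 =
      (-1) ^ (k + 1) * (k ! : ℂ) * ((1 - 1 / 2 ^ (k + 1)) * riemannZeta ((k + 1 : ℕ) : ℂ)) := by
    rw [← hG, tsum_mul_left, hO]
  have hfk : (k ! : ℂ) ≠ 0 := by exact_mod_cast Nat.factorial_ne_zero _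
  have hfk1 : ((k + 1)! : ℂ) ≠ 0 := by exact_mod_cast Nat.factorial_ne_zero _
  have hD : iteratedDeriv (k + 1) (fun s ↦ Complex.log (riemannXi s)) 1 =
      ((k + 1)! : ℂ) * logXiTaylorCoeff (k + 1) := by
    unfold logXiTaylorCoeff
    field_simp
  have hQ : iteratedDeriv k (logDeriv riemannZeta₁) 1 = (k ! : ℂ) * zetaOneLogDerivCoeff k := by
    unfold zetaOneLogDerivCoeff
    field_simp
  rw [hD, h2, h3, iteratedDeriv_inv_one, hG', hQ, Nat.factorial_succ] at h1
  push_cast at h1 ⊢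
  apply mul_left_cancel₀ hfk
  linear_combination h1

/-! ## The convolution determining `q_m` from `u_i` -/

/-- `u_0 = 1`. [folklore] -/
@[simp] theorem zetaOneTaylorCoeff_zero : zetaOneTaylorCoeff 0 = 1 := by
  simp [zetaOneTaylorCoeff, riemannZeta₁_one]

/-- The `u_i` are real. [folklore] -/
theorem zetaOneTaylorCoeff_im (i : ℕ) : (zetaOneTaylorCoeff i).im = 0 := by
  have h := iteratedDeriv_conj_of_conj riemannZeta₁_conj i 1
  rw [map_one] at h
  have him : (iteratedDeriv i riemannZeta₁ 1).im = 0 := Complex.conj_eq_iff_im.1 h.symm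
  rw [zetaOneTaylorCoeff, Complex.div_natCast_im, him, zero_div]

/-- **Leibniz on `ζ₁ · (ζ₁'/ζ₁) = ζ₁'`**: `Σ_{i≤m} u_i q_{m−i} = (m+1) u_{m+1}`. [cite: Keiper1992, §2] -/
theorem sum_zetaOneTaylorCoeff_mul (m : ℕ) :
    ∑ i ∈ range (m + 1), zetaOneTaylorCoeff i * zetaOneLogDerivCoeff (m - i) =
      ((m : ℂ) + 1) * zetaOneTaylorCoeff (m + 1) := by
  have hev : (fun z ↦ riemannZeta₁ z * logDeriv riemannZeta₁ z) =ᶠ[𝓝 (1 : ℂ)]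
      deriv riemannZeta₁ := by
    filter_upwards [riemannZeta₁_ne_zero_of_near_one] with z hz
    rw [logDeriv_apply]
    field_simp
  have hkey : iteratedDeriv m (fun z ↦ riemannZeta₁ z * logDeriv riemannZeta₁ z) 1 =
      iteratedDeriv (m + 1) riemannZeta₁ 1 := by
    rw [hev.iteratedDeriv_eq, iteratedDeriv_succ']
  rw [iteratedDeriv_fun_mul (differentiable_riemannZeta₁.contDiff.contDiffAt)
    analyticAt_logDeriv_riemannZeta₁_one.contDiffAt] at hkey
  have hu : ∀ i, iteratedDeriv i riemannZeta₁ 1 = (i ! : ℂ) * zetaOneTaylorCoeff i := fun i ↦ by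
    have hi : (i ! : ℂ) ≠ 0 := by exact_mod_cast Nat.factorial_ne_zero _
    unfold zetaOneTaylorCoeff
    field_simp
  have hq : ∀ i, iteratedDeriv i (logDeriv riemannZeta₁) 1 =
      (i ! : ℂ) * zetaOneLogDerivCoeff i := fun i ↦ by
    have hi : (i ! : ℂ) ≠ 0 := by exact_mod_cast Nat.factorial_ne_zero _
    unfold zetaOneLogDerivCoeff
    field_simp
  simp_rw [hu, hq] at hkey
  have hsum : ∑ i ∈ range (m + 1), (m.choose i : ℂ) * ((i ! : ℂ) * zetaOneTaylorCoeff i) *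
        (((m - i)! : ℂ) * zetaOneLogDerivCoeff (m - i)) =
      (m ! : ℂ) * ∑ i ∈ range (m + 1), zetaOneTaylorCoeff i * zetaOneLogDerivCoeff (m - i) := by
    rw [mul_sum]
    refine sum_congr rfl fun i hi ↦ ?_
    have := Nat.choose_mul_factorial_mul_factorial (Nat.lt_succ_iff.mp (mem_range.mp hi))
    rw [← this]
    push_cast
    ring
  rw [hsum, Nat.factorial_succ] at hkey
  push_cast at hkey
  have hfm : (m ! : ℂ) ≠ 0 := by exact_mod_cast Nat.factorial_ne_zero _
  apply mul_left_cancel₀ hfm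
  linear_combination hkey

/-! ## Sanity values: `a_0 = −log 2`, `u_1 = γ` -/

/-- `u_1 = γ` (Euler–Mascheroni). [folklore] -/
theorem zetaOneTaylorCoeff_one : zetaOneTaylorCoeff 1 = (Real.eulerMascheroniConstant : ℂ) := by
  simp [zetaOneTaylorCoeff, deriv_riemannZeta₁_one]

end Literature.NumberTheory.LFunctions.Xiao2020
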